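/-
Copyright (c) 2026 the pub-hodgecm-mathlib formalisation cell (harness21).  Prover seat hodgecm-mathlib-F0P3-p01 (g31), «(D-RAM) FOUR-FRAME» road of crux H413, line LH4,
unit U3_Laws, κ-STAGE B brick κG₂ «G₁-κ» (dealer LH4-plan (g11) WORD #52 (a); letter LH4-p09 (g3) `F0/P3c/LH4/LH4-p09/g3/LETTER-kappaBG-tv2.v1.LH4p09g3.md` §1,
κ owner LH4-p05 (g3)).  FILE κG₂-A2 — THE κ-COUNT OF THE TYPE-2 GLUED CLASS REPRESENTATIVE, COSET BY COSET.  2026-09-04.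
-/
import Summits.HodgeConjecture.HodgeConjecture.Theorems.F0P3cDyRamDiagonalKappaGluedClass                    -- ★ κG-A2 p856675 (LH4-p09 (g3)): `chiVec_zero_eq_one_of_window`; brings ★ κG-A1, ★ Fκ1∕Fκ2, ★ NormSignConductor
import Summits.HodgeConjecture.HodgeConjecture.Theorems.F0P3cDyRamDiagonalGluedPolarisationCountTypeTwo       -- ★ G2-B p856515 (LH4-p08 (g3)): `explicitForm_polarises_and_fParam`, `coset_eq_of_exists`; brings ★ G2-A1∕A2, ★ p856270, ★ p856076
import Literature.NumberTheory.LocalFields.WildQuadraticDatumTraceBound                                      -- ★ (LH4-p07 (g3)): `trace_bound_of_isRamifiedQuadraticDatum`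
import HarnessLib

/-!
# Crux `H413`, κ-STAGE B brick κG₂, FILE A2: `kappaCount σ ϖ 2 i (latt V(1,1,g))` on the type-2 glued stratum — the cosets parametrised by the (R)-parameters modulo `𝔭^{ρ+2t+1}`

Cell `hodgecm-mathlib` (D-0151), FLOOR 0, crux item H413 = `stmt-HodgeConjecture-24833`; lane `--supports stmt-HodgeConjecture-24833 --as helper` (count-neutral).  THEOREMS ONLY
(no `def`, no instance, no notation, no `sorry`).  The type-2 twin of ★ κG-A2 p856675 (LH4-p09 (g3)).  Representative `V = (1 0 0; 1 ϖ^ρ 0; 1+g ϖ^ρ ϖ^{2ρ+2t+1})`, `g` fixed,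
`|g| = |ϖ|^{2t}`, `ρ, t ≥ 1`.  At vertex type 2 the polarisation cosets of `latt V` are NOT one but `q^{1−ρ%2}` (★ G2-B): they are parametrised by the σ-fixed (R)-parameters
`f ≡ g (𝔭^{ρ+2t})` modulo `𝔭^{ρ+2t+1}` through LH4-p08 (g3)'s explicit section `D(f)` (★ `explicitForm_polarises_and_fParam`) and class criterion (★ G2-A2
`exists_stabiliser_iff_v_fParam_sub_le`); so for any complete irredundant finite system `S` of such parameters
`kappaCount σ ϖ 2 i (latt V) = Σ_{f ∈ S} cosetKappa σ i (D(f)·S_F)` (§4), and each coset is evaluated by ★ Fκ2 `cosetKappa_coset_eq_of_dichotomy`: ALIVE iff `χ_i ≡ 1` on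
`S_F(latt V)` — at the type-2 corner `S_F` is `|u₂−u₁| ≤ |ϖ|^{ρ+2t+1} ∧ |g⁻¹(u₂−u₁) + (u₂−u₀)| ≤ |ϖ|^{2ρ+1}` (§1, ★ p856076 (b)(c′) at `e = 1`), giving the WINDOWS `2d ≤ ρ+2t+2`
(slot 0) ∕ `2d ≤ ρ+2` (slots 1, 2) (§2 deep norms ★ `normSign_eq_one_of_fixed_of_v_sub_one_le`; §3 killers from the level-`(d−1)` non-norm ★ `exists_fixed_unit_not_norm_v_sub_one_le`) —
and the sign `χ_i(D(f))` = `ω(−1)ω(1+f)`, `ω(−1)ω(f)ω(1+f)`, `ω(f)` (§2b: `D(f) = P·(−g²(1+f)∕f, −(1+f), 1)`, `P = (ϖσϖ)^{−(ρ+t)}` a norm, `g² = gσg` a norm).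
HEAD of this file: **`forall_chiVec_eq_one_iff_window_two`** (the ALIVE predicate of `S_F` is the window); the κ-count itself
`kappaCount σ ϖ 2 i (latt V) = Σ_{f ∈ S} (![ [2d ≤ ρ+2t+2]·ω(−1)ω(1+f), [2d ≤ ρ+2]·ω(−1)ω(f)ω(1+f), [2d ≤ ρ+2]·ω(f) ] i)` is the sequel `…KappaGluedClassTwoCount` (§4, size split).
(The letter's per-lattice values — `q^{1−ρ%2}` × the type-0 bracket, with CANCELLATION at the one extra alive level for even `ρ` — follow by summing over `S`; the socket κG₂-C2
sums over ALL classes at once, where ★ κG-B2's character sums at level `ρ+1+2t` do exactly that.)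
HONEST LABEL.  Count-neutral (`--supports`); the κ-laws stay PROVER TARGETS; `HC_CM` is proved only modulo the 7 printed citations (2 remaining named inputs: hLiu418 =
`stmt-HodgeConjecture-24832`, h413 = `stmt-HodgeConjecture-24833`) until rung 0 closes.

## References
* [Kottwitz1986BaseChangeUnits] R. E. Kottwitz, *Base change for unit elements of Hecke algebras*, Compositio Math. 60 (1986), §1 pp. 240–241 (fixed-lattice counts via torus orbits).
* [LanglandsShelstad1987] R. P. Langlands, D. Shelstad, *On the definition of transfer factors*, Math. Ann. 278 (1987), §3 (the κ-signs).
* [Serre1979] J.-P. Serre, *Local Fields*, GTM 67 (1979), Ch. V §3 Prop. 5, Cor. 3; Ch. XV §2 (norm groups of ramified quadratic extensions, conductor).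
-/

set_option autoImplicit false

noncomputable section

namespace Summit.HodgeConjecture.HodgeConjecture.Cruxes.H413.F0P3cDyRamDiagonalKappaGluedClassTwo

open Matrix
open Literature.NumberTheory.Automorphic Literature.NumberTheory.Automorphic.HermitianLattice Literature.NumberTheory.Automorphic.UnitaryGroup
open Literature.NumberTheory.Automorphic.UnitaryLatticeTree Literature.NumberTheory.Automorphic.UnitaryThreeFourFrame
open Literature.NumberTheory.LocalFields.WildQuadraticDatum
open Summit.HodgeConjecture.HodgeConjecture.Cruxes.H413.F0P3cDyRamDiagonalTorusDefs
open Summit.HodgeConjecture.HodgeConjecture.Cruxes.H413.F0P3cDyRamDiagonalStrataDefs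
open Summit.HodgeConjecture.HodgeConjecture.Cruxes.H413.F0P3cDyRamDiagonalKappaCountDefs
open Summit.HodgeConjecture.HodgeConjecture.Cruxes.H413.F0P3cDyRamDiagonalKappaCountEval hiding normSign_mul_of_dichotomy
open Summit.HodgeConjecture.HodgeConjecture.Cruxes.H413.F0P3cDyRamFixedCountDiagonalModel (normSign_mul_norm)
open Summit.HodgeConjecture.HodgeConjecture.Cruxes.H413.F0P3cDyRamStableSumSignClasses (normSign_eq_one_or)
open Summit.HodgeConjecture.HodgeConjecture.Cruxes.H413.F0P3cDyRamDiagonalKappaGluedClass (chiVec_zero_eq_one_of_window)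
open Summit.HodgeConjecture.HodgeConjecture.Cruxes.H413.F0P3cDyRamDiagonalGluedStabiliserIndexCorner (mem_fixedUnitStabilizer_latt_glued_corner_iff)
open Summit.HodgeConjecture.HodgeConjecture.Cruxes.H413.F0P3cDyRamDiagonalGluedPolarisationStructureTypeTwo (structure_of_polarisation)
open Summit.HodgeConjecture.HodgeConjecture.Cruxes.H413.F0P3cDyRamDiagonalGluedPolarisationClassesTypeTwo (exists_stabiliser_iff_v_fParam_sub_le)
open Summit.HodgeConjecture.HodgeConjecture.Cruxes.H413.F0P3cDyRamDiagonalGluedPolarisationCountTypeTwo (explicitForm_polarises_and_fParam mem_coset_self coset_eq_of_exists)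
open scoped Valued WithZero Matrix MatrixGroups

variable {K : Type} [Field K] [Valued K ℤᵐ⁰]

/-! ## §1  The fixed stabiliser of the type-2 representative -/

/-- **`S_F(latt V(1,1,g))` AT THE TYPE-2 CORNER** (★ p856076 `mem_fixedUnitStabilizer_latt_glued_corner_iff` at `e = 1` with the lineariser `g⁻¹`): for `u ∈ 𝒰_F`,
`u ∈ S_F ⟺ |u₂ − u₁| ≤ |ϖ|^{ρ+2t+1} ∧ |g⁻¹(u₂ − u₁) + (u₂ − u₀)| ≤ |ϖ|^{2ρ+1}`. [cite: Kottwitz1986BaseChangeUnits, §1 pp. 240–241] -/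
theorem mem_fixedUnitStabilizer_glued_rep_two_iff {σ : K →+* K} {ϖ : K} (hϖ0 : ϖ ≠ 0) (hϖ1 : Valued.v ϖ ≤ 1) (ρ t : ℕ) {g : K}
    (hg : Valued.v g = Valued.v ϖ ^ (2 * t)) (V : GL (Fin 3) K)
    (hV : (V : Matrix (Fin 3) (Fin 3) K) = !![1, 0, 0; 1, ϖ ^ ρ, 0; 1 * 1 + g, ϖ ^ ρ * 1, ϖ ^ (2 * ρ + 2 * t + 1)])
    {u : Fin 3 → Kˣ} (hu : u ∈ fixedUnitTorus σ 3) :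
    u ∈ fixedUnitStabilizer σ (latt (V : Matrix (Fin 3) (Fin 3) K)) ↔
      Valued.v ((u 2 : K) - u 1) ≤ Valued.v ϖ ^ (ρ + 2 * t + 1) ∧ Valued.v (g⁻¹ * ((u 2 : K) - u 1) + ((u 2 : K) - u 0)) ≤ Valued.v ϖ ^ (2 * ρ + 1) := by
  have hvϖ : 0 < Valued.v ϖ := (Valuation.pos_iff _).2 hϖ0
  have hg0 : g ≠ 0 := fun h => by rw [h, map_zero] at hg; exact (pow_ne_zero _ hvϖ.ne') hg.symm
  have hg' : Valued.v g⁻¹ * Valued.v ϖ ^ (2 * t) ≤ 1 := by rw [map_inv₀, hg, inv_mul_cancel₀ (pow_ne_zero _ hvϖ.ne')]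
  have hlin : Valued.v ((1 : K) * 1 - g⁻¹ * g) ≤ Valued.v ϖ ^ ρ := by rw [one_mul, inv_mul_cancel₀ hg0, sub_self, map_zero]; exact zero_le
  exact mem_fixedUnitStabilizer_latt_glued_corner_iff hϖ0 hϖ1 ρ (2 * t) 1 (x := 1) (ζ := 1) (by simp) (by simp) hg hg' hlin V hV hu

section Alive

variable [CompleteSpace K] [Finite 𝓀[K]] {σ : K →+* K} {ϖ : K} {d t₂ : ℕ}

/-! ## §2  The ALIVE windows at the type-2 corner -/

/-- **WINDOW `i = 1, 2` (type 2): `2d ≤ ρ + 2` ⟹ `χ_1, χ_2 ≡ 1` on `S_F(latt V(1,1,g))`**: with `a = u₁∕u₂`, `b = u₀∕u₂` the type-2 congruences give `|a − 1| ≤ |ϖ|^{ρ+2t+1}` and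
`|b − 1| ≤ |ϖ|^{ρ+1}`, and `2d − 1 ≤ ρ + 1`; `χ_1(u) = ω(b)`, `χ_2(u) = ω(b)ω(a)`. [cite: Serre1979, Ch. V §3 Prop. 5, Cor. 3] [cite: LanglandsShelstad1987, §3] -/
theorem chiVec_one_two_eq_one_of_window_two (hD : IsRamifiedQuadraticDatum σ ϖ d t₂) {ρ t : ℕ} (hwin : 2 * d ≤ ρ + 2) {g : K}
    (hg : Valued.v g = Valued.v ϖ ^ (2 * t)) {u : Fin 3 → Kˣ} (hu : u ∈ fixedUnitTorus σ 3)
    (hb : Valued.v ((u 2 : K) - u 1) ≤ Valued.v ϖ ^ (ρ + 2 * t + 1)) (hc : Valued.v (g⁻¹ * ((u 2 : K) - u 1) + ((u 2 : K) - u 0)) ≤ Valued.v ϖ ^ (2 * ρ + 1)) :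
    chiVec σ 1 (fun j => ((u j : Kˣ) : K)) = 1 ∧ chiVec σ 2 (fun j => ((u j : Kˣ) : K)) = 1 := by
  have hϖ := hD.2.2.1
  have hϖ0 : ϖ ≠ 0 := (Valuation.ne_zero_iff _).1 (by rw [hϖ]; exact WithZero.exp_ne_zero)
  have hϖ1 : Valued.v ϖ < 1 := by rw [hϖ, ← WithZero.exp_zero, WithZero.exp_lt_exp]; norm_num
  have hvϖ : 0 < Valued.v ϖ := (Valuation.pos_iff _).2 hϖ0
  obtain ⟨hu1, hu2⟩ := (mem_fixedUnitTorus_iff σ u).1 hu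
  have h0 : ∀ j, ((u j : Kˣ) : K) ≠ 0 := fun j => (u j).ne_zero
  have hg0 : g ≠ 0 := fun h => by rw [h, map_zero] at hg; exact (pow_ne_zero _ hvϖ.ne') hg.symm
  -- `a = u₁∕u₂`
  have hσa : σ ((u 1 : K) / u 2) = (u 1 : K) / u 2 := by rw [map_div₀, hu2, hu2]
  have ha1 : Valued.v ((u 1 : K) / u 2 - 1) ≤ Valued.v ϖ ^ (ρ + 1) := by
    rw [div_sub_one (h0 2), map_div₀, hu1 2, div_one, show ((u 1 : K)) - u 2 = -(((u 2 : K)) - u 1) by ring, Valuation.map_neg]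
    refine hb.trans ?_
    rw [show ρ + 2 * t + 1 = (ρ + 1) + 2 * t by ring, pow_add]; exact mul_le_of_le_one_right zero_le (pow_le_one₀ zero_le hϖ1.le)
  -- `b = u₀∕u₂`
  have hσb : σ ((u 0 : K) / u 2) = (u 0 : K) / u 2 := by rw [map_div₀, hu2, hu2]
  have hb1 : Valued.v ((u 0 : K) / u 2 - 1) ≤ Valued.v ϖ ^ (ρ + 1) := by
    have e : (u 0 : K) / u 2 - 1 = (g⁻¹ * ((u 2 : K) - u 1) - (g⁻¹ * ((u 2 : K) - u 1) + ((u 2 : K) - u 0))) / u 2 := by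
      field_simp; ring
    rw [e, map_div₀, hu1 2, div_one]
    refine (Valuation.map_sub _ _ _).trans (max_le ?_ (hc.trans ?_))
    · rw [map_mul, map_inv₀, hg]
      calc (Valued.v ϖ ^ (2 * t))⁻¹ * Valued.v ((u 2 : K) - u 1) ≤ (Valued.v ϖ ^ (2 * t))⁻¹ * Valued.v ϖ ^ (ρ + 2 * t + 1) :=
            mul_le_mul_right hb _
        _ = Valued.v ϖ ^ (ρ + 1) := by
            rw [show ρ + 2 * t + 1 = (ρ + 1) + 2 * t by ring, pow_add, mul_comm (Valued.v ϖ ^ (ρ + 1)), ← mul_assoc,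
              inv_mul_cancel₀ (pow_ne_zero _ hvϖ.ne'), one_mul]
    · rw [show 2 * ρ + 1 = (ρ + 1) + ρ by ring, pow_add]; exact mul_le_of_le_one_right zero_le (pow_le_one₀ zero_le hϖ1.le)
  have hωa : normSign σ ((u 1 : K) / u 2) = 1 := normSign_eq_one_of_fixed_of_v_sub_one_le hD hσa (n := ρ + 1) (by omega) ha1
  have hωb : normSign σ ((u 0 : K) / u 2) = 1 := normSign_eq_one_of_fixed_of_v_sub_one_le hD hσb (n := ρ + 1) (by omega) hb1
  have hN2 : ∀ x : K, normSign σ (x * ((u 2 : K) * (u 2 : K))) = normSign σ x := fun x => by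
    nth_rw 2 [← hu2 2]; exact normSign_mul_norm σ x (h0 2)
  have e1 : ((u 0 : K)) * (u 2 : K) = ((u 0 : K) / u 2) * ((u 2 : K) * (u 2 : K)) := by field_simp
  have e2 : ((u 0 : K)) * (u 1 : K) = (((u 0 : K) / u 2) * ((u 1 : K) / u 2)) * ((u 2 : K) * (u 2 : K)) := by field_simp
  have hdiv0 : ∀ j, (u j : K) / u 2 ≠ 0 := fun j => div_ne_zero (h0 j) (h0 2)
  rw [chiVec_eq, chiVec_eq]
  simp only [Fin.isValue, Matrix.cons_val_one, Matrix.cons_val_zero, Matrix.cons_val_two, Matrix.head_cons, Matrix.tail_cons]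
  refine ⟨?_, ?_⟩
  · rw [← normSign_mul_of_fixed hD (hu2 0) (hu2 2) (h0 0) (h0 2), e1, hN2, hωb]
  · rw [← normSign_mul_of_fixed hD (hu2 0) (hu2 1) (h0 0) (h0 1), e2, hN2, normSign_mul_of_fixed hD hσb hσa (hdiv0 0) (hdiv0 1), hωa, hωb, mul_one]

/-! ## §2b  The κ-characters of the explicit section `D(f)` -/

/-- **THE SIGNS OF LH4-p08 (g3)'s SECTION `D(f)` AT THE REPRESENTATIVE**: for `g`, `f` fixed and non-zero with `1 + f ≠ 0`, the form
`D(f) = (−P·((g−f)²∕f) − (−P(1+f) + (1+g)·P·(1+g)), −P(1+f), P)`, `P = ((ϖσϖ)^{ρ+t})⁻¹`, has `D(f)₀ = −P·g²(1+f)∕f` and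
`χ_0 = ω(−1)ω(1+f)`, `χ_1 = ω(−1)ω(f)ω(1+f)`, `χ_2 = ω(f)` (`P` and `g² = gσg` are norms, `ω(f⁻¹) = ω(f)`, `ω² = 1`). [cite: LanglandsShelstad1987, §3] [cite: Serre1979, Ch. V §3] -/
theorem chiVec_section_two (hD : IsRamifiedQuadraticDatum σ ϖ d t₂) (ρ t : ℕ) {g f : K} (hσg : σ g = g) (hg0 : g ≠ 0) (hσf : σ f = f) (hf0 : f ≠ 0)
    (h1f : 1 + f ≠ 0) (i : Fin 3) :
    chiVec σ i (![-((((ϖ * σ ϖ) ^ (ρ + t))⁻¹) * ((1 * σ g - σ 1 * f) * (σ 1 * g - 1 * f)) / f) -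
        (σ 1 * (-((((ϖ * σ ϖ) ^ (ρ + t))⁻¹) * (1 * σ 1 + f))) * 1 + σ (1 * 1 + g) * (((ϖ * σ ϖ) ^ (ρ + t))⁻¹) * (1 * 1 + g)),
      -((((ϖ * σ ϖ) ^ (ρ + t))⁻¹) * (1 * σ 1 + f)), (((ϖ * σ ϖ) ^ (ρ + t))⁻¹)] : Fin 3 → K) =
      (![normSign σ (-1) * normSign σ (1 + f), normSign σ (-1) * normSign σ f * normSign σ (1 + f), normSign σ f] : Fin 3 → ℤ) i := by
  obtain ⟨hσ, -, hϖ, -⟩ := id hD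
  have hϖ0 : ϖ ≠ 0 := (Valuation.ne_zero_iff _).1 (by rw [hϖ]; exact WithZero.exp_ne_zero)
  have hσϖ0 : σ ϖ ≠ 0 := fun h => hϖ0 (by rw [← hσ ϖ, h, map_zero])
  set P : K := ((ϖ * σ ϖ) ^ (ρ + t))⁻¹ with hP
  have hP0 : P ≠ 0 := by rw [hP]; exact inv_ne_zero (pow_ne_zero _ (mul_ne_zero hϖ0 hσϖ0))
  have hσP : σ P = P := by rw [hP, map_inv₀, map_pow, map_mul, hσ, mul_comm (σ ϖ)]
  have hωP : normSign σ P = 1 := by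
    refine normSign_of_isNorm σ ⟨(ϖ ^ (ρ + t))⁻¹, ?_⟩
    rw [hP, map_inv₀, map_pow, ← mul_inv, ← mul_pow]
  -- the entries
  have hD0 : -(P * ((1 * σ g - σ 1 * f) * (σ 1 * g - 1 * f)) / f) - (σ 1 * (-(P * (1 * σ 1 + f))) * 1 + σ (1 * 1 + g) * P * (1 * 1 + g)) =
      -(P * (g * g) * (1 + f) * f⁻¹) := by
    rw [map_one, hσg, map_add, map_mul, map_one, hσg]
    field_simp
    ring
  have hD1 : -(P * (1 * σ 1 + f)) = -(P * (1 + f)) := by rw [map_one, one_mul]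
  have hσ1f : σ (1 + f) = 1 + f := by rw [map_add, map_one, hσf]
  have hσm1 : σ (-1 : K) = -1 := by rw [map_neg, map_one]
  have hσgg : σ (g * g) = g * g := by rw [map_mul, hσg]
  have hσfi : σ f⁻¹ = f⁻¹ := by rw [map_inv₀, hσf]
  have hgg0 : g * g ≠ 0 := mul_ne_zero hg0 hg0
  have hfi0 : f⁻¹ ≠ 0 := inv_ne_zero hf0
  have hωgg : normSign σ (g * g) = 1 := normSign_of_isNorm σ ⟨g, by rw [hσg]⟩
  have hωfi : normSign σ f⁻¹ = normSign σ f := normSign_inv_of_map_eq σ hσf hf0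
  -- `ω` of the entries (multiplicativity on fixed non-zero elements, ★ `normSign_mul_of_fixed`)
  have hω1 : normSign σ (-(P * (1 + f))) = normSign σ (-1) * normSign σ (1 + f) := by
    rw [show -(P * (1 + f)) = (-1) * (P * (1 + f)) by ring,
      normSign_mul_of_fixed hD hσm1 (by rw [map_mul, hσP, hσ1f]) (by norm_num) (mul_ne_zero hP0 h1f),
      normSign_mul_of_fixed hD hσP hσ1f hP0 h1f, hωP, one_mul]
  have hω0 : normSign σ (-(P * (g * g) * (1 + f) * f⁻¹)) = normSign σ (-1) * normSign σ (1 + f) * normSign σ f := by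
    rw [show -(P * (g * g) * (1 + f) * f⁻¹) = (-1) * ((P * (g * g)) * ((1 + f) * f⁻¹)) by ring,
      normSign_mul_of_fixed hD hσm1 (by rw [map_mul, map_mul, hσP, hσgg, map_mul, hσ1f, hσfi]) (by norm_num)
        (mul_ne_zero (mul_ne_zero hP0 hgg0) (mul_ne_zero h1f hfi0)),
      normSign_mul_of_fixed hD (by rw [map_mul, hσP, hσgg]) (by rw [map_mul, hσ1f, hσfi]) (mul_ne_zero hP0 hgg0) (mul_ne_zero h1f hfi0),
      normSign_mul_of_fixed hD hσP hσgg hP0 hgg0, normSign_mul_of_fixed hD hσ1f hσfi h1f hfi0, hωP, hωgg, hωfi, one_mul, one_mul, mul_assoc]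
  have hsq : ∀ x : K, normSign σ x * normSign σ x = 1 := fun x => by rcases normSign_eq_one_or σ x with h | h <;> rw [h] <;> norm_num
  rw [chiVec_eq]
  fin_cases i
  · simp only [Fin.zero_eta, Fin.isValue, Matrix.cons_val_zero, Matrix.cons_val_one, Matrix.cons_val_two, Matrix.head_cons, Matrix.tail_cons]
    rw [hD1, hω1, hωP, mul_one]
  · simp only [Fin.mk_one, Fin.isValue, Matrix.cons_val_zero, Matrix.cons_val_one, Matrix.cons_val_two, Matrix.head_cons, Matrix.tail_cons]
    rw [hD0, hω0, hωP, mul_one]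
    ring
  · simp only [Fin.reduceFinMk, Fin.isValue, Matrix.cons_val_zero, Matrix.cons_val_one, Matrix.cons_val_two, Matrix.head_cons, Matrix.tail_cons]
    rw [hD0, hD1, hω0, hω1]
    have h1 := hsq (-1 : K)
    have h2 := hsq (1 + f)
    linear_combination (normSign σ f * (normSign σ (-1) * normSign σ (-1))) * h2 + normSign σ f * h1

end Alive

/-! ## §3  The killers at the type-2 corner -/

/-- **KILLER FOR `i = 0` (type 2)**: a `σ`-fixed NON-norm unit `n₀` with `|n₀ − 1| ≤ |ϖ|^{ρ+2t+1}` (`ρ ≥ 1`) gives `u = (1 + g⁻¹(1 − n₀), n₀, 1) ∈ S_F(latt V(1,1,g))` with `χ_0(u) = −1`.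
[cite: Kottwitz1986BaseChangeUnits, §1 pp. 240–241] [cite: LanglandsShelstad1987, §3] -/
theorem exists_mem_fixedUnitStabilizer_two_chiVec_zero_ne_one {σ : K →+* K} {ϖ : K} (hϖ0 : ϖ ≠ 0) (hϖ1 : Valued.v ϖ < 1)
    {ρ : ℕ} (hρ : 1 ≤ ρ) (t : ℕ) {g : K} (hσg : σ g = g) (hg : Valued.v g = Valued.v ϖ ^ (2 * t)) (V : GL (Fin 3) K)
    (hV : (V : Matrix (Fin 3) (Fin 3) K) = !![1, 0, 0; 1, ϖ ^ ρ, 0; 1 * 1 + g, ϖ ^ ρ * 1, ϖ ^ (2 * ρ + 2 * t + 1)])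
    {n₀ : K} (hσn₀ : σ n₀ = n₀) (hn₀1 : Valued.v n₀ = 1) (hn₀ : Valued.v (n₀ - 1) ≤ Valued.v ϖ ^ (ρ + 2 * t + 1)) (hn₀n : ¬ ∃ z : K, z * σ z = n₀) :
    ∃ u ∈ fixedUnitStabilizer σ (latt (V : Matrix (Fin 3) (Fin 3) K)), chiVec σ 0 (fun j => ((u j : Kˣ) : K)) ≠ 1 := by
  have hvϖ : 0 < Valued.v ϖ := (Valuation.pos_iff _).2 hϖ0
  have hg0 : g ≠ 0 := fun h => by rw [h, map_zero] at hg; exact (pow_ne_zero _ hvϖ.ne') hg.symm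
  have hn₀0 : n₀ ≠ 0 := fun h => by rw [h, map_zero] at hn₀1; exact zero_ne_one hn₀1
  have hsmall : Valued.v (g⁻¹ * (1 - n₀)) < 1 := by
    rw [map_mul, map_inv₀, hg, show (1 : K) - n₀ = -(n₀ - 1) by ring, Valuation.map_neg]
    calc (Valued.v ϖ ^ (2 * t))⁻¹ * Valued.v (n₀ - 1) ≤ (Valued.v ϖ ^ (2 * t))⁻¹ * Valued.v ϖ ^ (ρ + 2 * t + 1) := mul_le_mul_right hn₀ _
      _ = Valued.v ϖ ^ (ρ + 1) := by
          rw [show ρ + 2 * t + 1 = (ρ + 1) + 2 * t by ring, pow_add, mul_comm (Valued.v ϖ ^ (ρ + 1)), ← mul_assoc,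
            inv_mul_cancel₀ (pow_ne_zero _ hvϖ.ne'), one_mul]
      _ < 1 := pow_lt_one₀ zero_le hϖ1 (by omega)
  have hu₀1 : Valued.v (1 + g⁻¹ * (1 - n₀)) = 1 := Valued.v.map_one_add_of_lt hsmall
  have hu₀0 : 1 + g⁻¹ * (1 - n₀) ≠ 0 := fun h => by rw [h, map_zero] at hu₀1; exact zero_ne_one hu₀1
  have hσu₀ : σ (1 + g⁻¹ * (1 - n₀)) = 1 + g⁻¹ * (1 - n₀) := by rw [map_add, map_one, map_mul, map_inv₀, hσg, map_sub, map_one, hσn₀]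
  let u : Fin 3 → Kˣ := ![Units.mk0 _ hu₀0, Units.mk0 n₀ hn₀0, 1]
  have hu0 : ((u 0 : Kˣ) : K) = 1 + g⁻¹ * (1 - n₀) := rfl
  have hu1 : ((u 1 : Kˣ) : K) = n₀ := rfl
  have hu2 : ((u 2 : Kˣ) : K) = 1 := rfl
  have hu : u ∈ fixedUnitTorus σ 3 := by
    rw [mem_fixedUnitTorus_iff]
    refine ⟨fun j => ?_, fun j => ?_⟩
    · fin_cases j
      · exact hu₀1
      · exact hn₀1
      · exact map_one _
    · fin_cases j
      · exact hσu₀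
      · exact hσn₀
      · exact map_one _
  refine ⟨u, ?_, ?_⟩
  · refine (mem_fixedUnitStabilizer_glued_rep_two_iff hϖ0 hϖ1.le ρ t hg V hV hu).2 ⟨?_, ?_⟩
    · rw [hu2, hu1, show (1 : K) - n₀ = -(n₀ - 1) by ring, Valuation.map_neg]; exact hn₀
    · rw [hu2, hu1, hu0, show g⁻¹ * (1 - n₀) + (1 - (1 + g⁻¹ * (1 - n₀))) = (0 : K) by ring, map_zero]; exact zero_le
  · rw [chiVec_eq]
    simp only [Fin.isValue, Matrix.cons_val_zero, hu1, hu2, normSign_one σ, mul_one, normSign_of_not_isNorm σ hn₀n]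
    decide

/-- **KILLER FOR `i = 1, 2` (type 2)**: a `σ`-fixed NON-norm unit `n₀` with `|n₀ − 1| ≤ |ϖ|^{ρ+1}` gives `u = (n₀, 1 − (n₀−1)g, 1) ∈ S_F(latt V(1,1,g))` with `χ_1(u) = −1` and,
if `ω(1 − (n₀−1)g) = 1`, `χ_2(u) = −1`. [cite: Kottwitz1986BaseChangeUnits, §1 pp. 240–241] [cite: LanglandsShelstad1987, §3] -/
theorem exists_mem_fixedUnitStabilizer_two_chiVec_one_two_ne_one {σ : K →+* K} {ϖ : K} (hϖ0 : ϖ ≠ 0) (hϖ1 : Valued.v ϖ < 1)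
    (ρ : ℕ) {t : ℕ} (ht : 1 ≤ t) {g : K} (hσg : σ g = g) (hg : Valued.v g = Valued.v ϖ ^ (2 * t)) (V : GL (Fin 3) K)
    (hV : (V : Matrix (Fin 3) (Fin 3) K) = !![1, 0, 0; 1, ϖ ^ ρ, 0; 1 * 1 + g, ϖ ^ ρ * 1, ϖ ^ (2 * ρ + 2 * t + 1)])
    {n₀ : K} (hσn₀ : σ n₀ = n₀) (hn₀1 : Valued.v n₀ = 1) (hn₀ : Valued.v (n₀ - 1) ≤ Valued.v ϖ ^ (ρ + 1)) (hn₀n : ¬ ∃ z : K, z * σ z = n₀) :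
    ∃ u ∈ fixedUnitStabilizer σ (latt (V : Matrix (Fin 3) (Fin 3) K)),
      chiVec σ 1 (fun j => ((u j : Kˣ) : K)) ≠ 1 ∧ (normSign σ (1 - (n₀ - 1) * g) = 1 → chiVec σ 2 (fun j => ((u j : Kˣ) : K)) ≠ 1) := by
  have hvϖ : 0 < Valued.v ϖ := (Valuation.pos_iff _).2 hϖ0
  have hg0 : g ≠ 0 := fun h => by rw [h, map_zero] at hg; exact (pow_ne_zero _ hvϖ.ne') hg.symm
  have hn₀0 : n₀ ≠ 0 := fun h => by rw [h, map_zero] at hn₀1; exact zero_ne_one hn₀1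
  have hm : Valued.v ((n₀ - 1) * g) ≤ Valued.v ϖ ^ (ρ + 2 * t + 1) := by
    rw [map_mul, hg, show ρ + 2 * t + 1 = (ρ + 1) + 2 * t by ring, pow_add]; exact mul_le_mul_left hn₀ _
  have hsmall : Valued.v (-((n₀ - 1) * g)) < 1 := by
    rw [Valuation.map_neg]; exact hm.trans_lt (pow_lt_one₀ zero_le hϖ1 (by omega))
  have hu₁1 : Valued.v (1 - (n₀ - 1) * g) = 1 := by rw [sub_eq_add_neg]; exact Valued.v.map_one_add_of_lt hsmall
  have hu₁0 : 1 - (n₀ - 1) * g ≠ 0 := fun h => by rw [h, map_zero] at hu₁1; exact zero_ne_one hu₁1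
  have hσu₁ : σ (1 - (n₀ - 1) * g) = 1 - (n₀ - 1) * g := by rw [map_sub, map_one, map_mul, map_sub, map_one, hσn₀, hσg]
  let u : Fin 3 → Kˣ := ![Units.mk0 n₀ hn₀0, Units.mk0 _ hu₁0, 1]
  have hu0 : ((u 0 : Kˣ) : K) = n₀ := rfl
  have hu1 : ((u 1 : Kˣ) : K) = 1 - (n₀ - 1) * g := rfl
  have hu2 : ((u 2 : Kˣ) : K) = 1 := rfl
  have hu : u ∈ fixedUnitTorus σ 3 := by
    rw [mem_fixedUnitTorus_iff]
    refine ⟨fun j => ?_, fun j => ?_⟩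
    · fin_cases j
      · exact hn₀1
      · exact hu₁1
      · exact map_one _
    · fin_cases j
      · exact hσn₀
      · exact hσu₁
      · exact map_one _
  refine ⟨u, ?_, ?_, fun hω => ?_⟩
  · refine (mem_fixedUnitStabilizer_glued_rep_two_iff hϖ0 hϖ1.le ρ t hg V hV hu).2 ⟨?_, ?_⟩
    · rw [hu2, hu1, show (1 : K) - (1 - (n₀ - 1) * g) = (n₀ - 1) * g by ring]; exact hm
    · rw [hu2, hu1, hu0, show g⁻¹ * ((1 : K) - (1 - (n₀ - 1) * g)) + (1 - n₀) = 0 by field_simp; ring, map_zero]; exact zero_le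
  · rw [chiVec_eq]
    simp only [Fin.isValue, Matrix.cons_val_one, Matrix.cons_val_zero, hu0, hu2, normSign_one σ, mul_one, normSign_of_not_isNorm σ hn₀n]
    decide
  · rw [chiVec_eq]
    simp only [Fin.isValue, Matrix.cons_val_two, Matrix.tail_cons, Matrix.head_cons, hu0, hu1, hω, mul_one,
      normSign_of_not_isNorm σ hn₀n]
    decide

/-! ## §4  The cosets parametrised by the (R)-parameters, and the HEAD -/

section Head

variable [CompleteSpace K] [Finite 𝓀[K]] {σ : K →+* K} {ϖ : K} {d t₂ : ℕ}

open Classical in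
/-- **THE ALIVE PREDICATE OF `S_F(latt V(1,1,g))` AT TYPE 2 IS THE WINDOW**: slot 0 `⟺ 2d ≤ ρ+2t+2`, slots 1, 2 `⟺ 2d ≤ ρ+2` (deep norms above, the level-`(d−1)` non-norm killer below).
[cite: Serre1979, Ch. V §3 Prop. 5, Cor. 3] [cite: LanglandsShelstad1987, §3] -/
theorem forall_chiVec_eq_one_iff_window_two (hD : IsRamifiedQuadraticDatum σ ϖ d t₂) (h2 : Valued.v (2 : K) < 1) {ρ t : ℕ} (hρ : 1 ≤ ρ) (ht : 1 ≤ t)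
    {g : K} (hσg : σ g = g) (hg : Valued.v g = Valued.v ϖ ^ (2 * t)) (V : GL (Fin 3) K)
    (hV : (V : Matrix (Fin 3) (Fin 3) K) = !![1, 0, 0; 1, ϖ ^ ρ, 0; 1 * 1 + g, ϖ ^ ρ * 1, ϖ ^ (2 * ρ + 2 * t + 1)]) (i : Fin 3) :
    (∀ u ∈ fixedUnitStabilizer σ (latt (V : Matrix (Fin 3) (Fin 3) K)), chiVec σ i (fun j => ((u j : Kˣ) : K)) = 1) ↔
      (![2 * d ≤ ρ + 2 * t + 2, 2 * d ≤ ρ + 2, 2 * d ≤ ρ + 2] : Fin 3 → Prop) i := by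
  obtain ⟨hσ, hvσ, hϖ, hfix, hdd, hd1, -⟩ := id hD
  have hϖ0 : ϖ ≠ 0 := (Valuation.ne_zero_iff _).1 (by rw [hϖ]; exact WithZero.exp_ne_zero)
  have hϖ1 : Valued.v ϖ < 1 := by rw [hϖ, ← WithZero.exp_zero, WithZero.exp_lt_exp]; norm_num
  -- a level-`(d−1)` non-norm for the killers
  obtain ⟨n₀, hσn₀, hn₀1, hn₀d, hn₀n⟩ := exists_fixed_unit_not_norm_v_sub_one_le hD h2
  have hn₀d' : Valued.v (n₀ - 1) ≤ Valued.v ϖ ^ (2 * (d - 1)) := by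
    rw [v_varpi_pow hϖ]; convert hn₀d using 2; push_cast; ring
  fin_cases i
  · simp only [Fin.zero_eta, Fin.isValue, Matrix.cons_val_zero]
    constructor
    · intro h
      by_contra hwin
      have hlev : Valued.v (n₀ - 1) ≤ Valued.v ϖ ^ (ρ + 2 * t + 1) := hn₀d'.trans (pow_le_pow_right_of_le_one' hϖ1.le (by omega))
      obtain ⟨u, hu, hne⟩ := exists_mem_fixedUnitStabilizer_two_chiVec_zero_ne_one hϖ0 hϖ1 hρ t hσg hg V hV hσn₀ hn₀1 hlev hn₀n
      exact hne (h u hu)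
    · intro hwin u hu
      have hu𝒰 : u ∈ fixedUnitTorus σ 3 := ((mem_fixedUnitStabilizer_iff σ _ u).1 hu).2
      have hb := ((mem_fixedUnitStabilizer_glued_rep_two_iff hϖ0 hϖ1.le ρ t hg V hV hu𝒰).1 hu).1
      exact chiVec_zero_eq_one_of_window hD (ρ := ρ + 1) (t := t) (by omega) hu𝒰 (by rw [show ρ + 1 + 2 * t = ρ + 2 * t + 1 by ring]; exact hb)
  · simp only [Fin.mk_one, Fin.isValue, Matrix.cons_val_one, Matrix.cons_val_zero]
    constructor
    · intro h
      by_contra hwin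
      have hlev : Valued.v (n₀ - 1) ≤ Valued.v ϖ ^ (ρ + 1) := hn₀d'.trans (pow_le_pow_right_of_le_one' hϖ1.le (by omega))
      obtain ⟨u, hu, hne, -⟩ := exists_mem_fixedUnitStabilizer_two_chiVec_one_two_ne_one hϖ0 hϖ1 ρ ht hσg hg V hV hσn₀ hn₀1 hlev hn₀n
      exact hne (h u hu)
    · intro hwin u hu
      have hu𝒰 : u ∈ fixedUnitTorus σ 3 := ((mem_fixedUnitStabilizer_iff σ _ u).1 hu).2
      obtain ⟨hb, hc⟩ := (mem_fixedUnitStabilizer_glued_rep_two_iff hϖ0 hϖ1.le ρ t hg V hV hu𝒰).1 hu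
      exact (chiVec_one_two_eq_one_of_window_two hD hwin hg hu𝒰 hb hc).1
  · simp only [Fin.reduceFinMk, Fin.isValue, Matrix.cons_val_two, Matrix.tail_cons, Matrix.head_cons]
    constructor
    · intro h
      by_contra hwin
      have hlev : Valued.v (n₀ - 1) ≤ Valued.v ϖ ^ (ρ + 1) := hn₀d'.trans (pow_le_pow_right_of_le_one' hϖ1.le (by omega))
      have hω : normSign σ (1 - (n₀ - 1) * g) = 1 := by
        refine normSign_eq_one_of_fixed_of_v_sub_one_le hD (by rw [map_sub, map_one, map_mul, map_sub, map_one, hσn₀, hσg])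
          (n := 2 * (d - 1) + 2 * t) (by omega) ?_
        rw [show (1 : K) - (n₀ - 1) * g - 1 = -((n₀ - 1) * g) by ring, Valuation.map_neg, map_mul, hg, pow_add]
        exact mul_le_mul_left hn₀d' _
      obtain ⟨u, hu, -, hne⟩ := exists_mem_fixedUnitStabilizer_two_chiVec_one_two_ne_one hϖ0 hϖ1 ρ ht hσg hg V hV hσn₀ hn₀1 hlev hn₀n
      exact hne hω (h u hu)
    · intro hwin u hu
      have hu𝒰 : u ∈ fixedUnitTorus σ 3 := ((mem_fixedUnitStabilizer_iff σ _ u).1 hu).2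
      obtain ⟨hb, hc⟩ := (mem_fixedUnitStabilizer_glued_rep_two_iff hϖ0 hϖ1.le ρ t hg V hV hu𝒰).1 hu
      exact (chiVec_one_two_eq_one_of_window_two hD hwin hg hu𝒰 hb hc).2

end Head

end Summit.HodgeConjecture.HodgeConjecture.Cruxes.H413.F0P3cDyRamDiagonalKappaGluedClassTwo

end
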